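import Literature.NumberTheory.LFunctions.RosserSchoenfeldMertensFirstConstant
import Literature.NumberTheory.LFunctions.MertensConstant
import Literature.NumberTheory.LFunctions.GeneralizedRH
import HarnessLib

/-!
# RH-EQUIVALENT (Thm 1) / RH-CONDITIONAL (Thm 2, Cor 1) criteria — «nothing here bears on the truth of RH»
# The mean values of the error terms in Mertens' theorems are positive exactly under RH (Zhao 2025, triage-typing)

TRIAGE-TYPING, AS PRINTED, with a status note and NO endorsement (RH literature-typing tranche 1 part 2,
director-rh 2026-08-26, D-0088(4) cross-ladder layer: an RH-EQUIVALENT in the Robin / Nicolas / Lagarias family, a 2025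
descendant of the tranche's named source — it cites [Suz] = Suzuki arXiv:2411.07436 for «related results involving
averages of some other error terms»). Source, read in full (held text `paper:arxiv-2411.18903`, 16 pp.):

> T. Zhao, *On the mean values of the error terms in Mertens' theorems*, Res. Number Theory **11** (2025), no. 3,
> Paper No. 62, doi:10.1007/s40993-025-00640-y = arXiv:2411.18903 [bib: `Zhao2025MertensMean`].

STATUS: PUBLISHED, refereed. Every printed theorem below is a NAMED FACT `def … : Prop` (D-0014); nothing is proved here
beyond the unfolding of the error terms onto the tree's Mertens vocabulary.

## Dictionary (tree vocabulary — cite, never restate)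

* `ℰ₁ := −γ_E − Σ_p Σ_{n≥2} (log p)/pⁿ = −1.3325…` IS the tree's Rosser–Schoenfeld constant `rosserSchoenfeldE`
  (`RosserSchoenfeldMertensFirst.lean`, RS62 (2.10): `−γ − Σ_p (log p)/(p(p−1))`, and `Σ_{n≥2} p^{-n} = 1/(p(p−1))`;
  Mertens' first theorem with this constant is the tree's `tendsto_sum_primesLE_log_div_sub_log`).
* `ℰ₂ := γ_E − Σ_p Σ_{n≥2} 1/(npⁿ) = 0.2614…` IS the tree's Meissel–Mertens constant `Mertens.meisselMertens`
  (`MertensConstant.lean`: `γ + Σ_p (log(1 − 1/p) + 1/p)`, and `log(1 − 1/p) = −Σ_{n≥1} 1/(npⁿ)`; Mertens' second theorem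
  is `Mertens.tendsto_primeRecipSum_sub_loglog`).
* `Σ_{p≤x} (log p)/p`, `Σ_{p≤x} 1/p`, `Π_{p≤x}(1 − 1/p)` → `Mertens.primeLogDivSum`, `Mertens.primeRecipSum`, the product over
  `Nat.primesLE ⌊x⌋₊` (as in `Mertens.tendsto_prod_one_sub_inv_inv_div_log`, Mertens' third theorem `→ e^γ`).
* `E₁(x) := Σ_{p≤x}(log p)/p − log x − ℰ₁`, `E₂(x) := Σ_{p≤x} 1/p − log log x − ℰ₂`,
  `E₃(x) := (log x)⁻¹ Π_{p≤x}(1 − 1/p)⁻¹ − e^{γ_E}` (§1.1) → `Zhao2025.E₁`, `Zhao2025.E₂`, `Zhao2025.E₃` (NEW abbreviations).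
* `Θ := sup{Re ρ : ζ(ρ) = 0}` (Thm 2): «`Θ = 1/2`» is RH (the zeros are symmetric under `ρ ↦ 1 − ρ̄`, so `Θ ≥ 1/2`
  always) and «`1/2 < Θ < 1`» is «RH fails and there is `δ > 0` with `Re ρ ≤ 1 − δ` for every non-trivial zero» — typed
  in these words, without a `Θ` symbol; `RiemannHypothesis` = Mathlib's.
* `B₁ := −2(ξ'/ξ)(0) = 2 + γ_E − log 4π = 0.0461…` ((1.2)) — written out as `2 + γ − log(4π)` in Cor 1.

## What is here (printed item → declaration → status)

* Thm 1 (for `i ∈ {1, 2}`: RH ⟺ `∫₂^X E_i(x) dx > 0` for all `X > 2`) → `Zhao2025MertensMean_thm1` — NAMED FACT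
  (RH-EQUIVALENT; printed proof: explicit formula and Landau's oscillation theorem, §3).
* Thm 2 (`E₃`: «If `Θ = 1/2`, then `∫₂^X E₃ > 0` for all `X > 2`. If `1/2 < Θ < 1` … then `∫₂^X E₃` changes sign
  infinitely often») → `Zhao2025MertensMean_thm2` — NAMED FACT (RH-CONDITIONAL first clause; the clause «`Θ = 1` and
  Assumption 1 holds» is NOT typed: Assumption 1 (§3.3) is a hypothesis on the shape of the sharp zero-free region, not a
  statement about `ζ`).
* Cor 1 (assuming RH, `∫_{cX}^X E_i > 0` for `X ≥ X₀(c)`, every `c < ((2 − B₁)/(2 + B₁))² = 0.9548…`, `i = 1, 2, 3`) →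
  `Zhao2025MertensMean_cor1` — NAMED FACT (RH-CONDITIONAL).
* NOT typed: the display (1.2) `2 − B₁ ≤ liminf f_i < limsup f_i = 2 + B₁` («it can be seen from the proofs», and its
  LI-refinement); Thm 3 (real primitive characters `χ_d`, `d` in a 178-element set `𝒟` given by two tables not reproduced
  in the held text); Thm 4 (progressions `a = 1 mod q`, `q` in the explicit 24-element set `𝒬`, with constants
  `ℰ_i(q, a)` the paper leaves implicit) and its LI-completeness clause; §5 problems.

Nothing in this file is, or is worded as, progress toward RH: Thm 1 is an equivalence, Thm 2 / Cor 1 are implications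
from RH (or from its failure).
-/

noncomputable section

open Filter Topology MeasureTheory
open scoped Real

namespace Literature.NumberTheory.LFunctions

namespace Zhao2025

/-- **`E₁(x) := Σ_{p≤x} (log p)/p − log x − ℰ₁`**, the error term in Mertens' first theorem, `ℰ₁ = rosserSchoenfeldE`
(module docstring). [cite: Zhao2025MertensMean, §1.1 (definition of E₁)] -/
def E₁ (x : ℝ) : ℝ := Mertens.primeLogDivSum x - Real.log x - rosserSchoenfeldE

/-- **`E₂(x) := Σ_{p≤x} 1/p − log log x − ℰ₂`**, the error term in Mertens' second theorem, `ℰ₂ = Mertens.meisselMertens`.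
[cite: Zhao2025MertensMean, §1.1 (definition of E₂)] -/
def E₂ (x : ℝ) : ℝ := Mertens.primeRecipSum x - Real.log (Real.log x) - Mertens.meisselMertens

/-- **`E₃(x) := (log x)⁻¹ Π_{p≤x} (1 − 1/p)⁻¹ − e^{γ}`**, the error term in Mertens' third theorem.
[cite: Zhao2025MertensMean, §1.1 (definition of E₃)] -/
def E₃ (x : ℝ) : ℝ :=
  (∏ p ∈ Nat.primesLE ⌊x⌋₊, (1 - (p : ℝ)⁻¹)⁻¹) / Real.log x - Real.exp Real.eulerMascheroniConstant

/-- `E₁ = τ − E` in the tree's notation (`Mertens.mertensTau x = Σ_{p≤x}(log p)/p − log x`).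
[cite: Zhao2025MertensMean, §1.1 (definition of E₁)] -/
theorem E₁_eq (x : ℝ) : E₁ x = Mertens.mertensTau x - rosserSchoenfeldE := rfl

/-- Mertens' first theorem in the form `E₁(x) → 0` (the tree's `tendsto_sum_primesLE_log_div_sub_log`).
[cite: Zhao2025MertensMean, §1.1 («E₁(x) = o(1)»)] -/
theorem tendsto_E₁ : Tendsto E₁ atTop (𝓝 0) := by
  have h := tendsto_sum_primesLE_log_div_sub_log.sub_const rosserSchoenfeldE
  rw [sub_self] at h
  exact h

/-- Mertens' second theorem in the form `E₂(x) → 0` (the tree's `Mertens.tendsto_primeRecipSum_sub_loglog`).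
[cite: Zhao2025MertensMean, §1.1 («E₂(x) = O(1/log x)»)] -/
theorem tendsto_E₂ : Tendsto E₂ atTop (𝓝 0) := by
  have h := Mertens.tendsto_primeRecipSum_sub_loglog.sub_const Mertens.meisselMertens
  rw [sub_self] at h
  exact h

/-- Mertens' third theorem in the form `E₃(x) → 0` (the tree's `Mertens.tendsto_prod_one_sub_inv_inv_div_log`).
[cite: Zhao2025MertensMean, §1.1 («E₃(x) = O(1/log x)»)] -/
theorem tendsto_E₃ : Tendsto E₃ atTop (𝓝 0) := by
  have h := Mertens.tendsto_prod_one_sub_inv_inv_div_log.sub_const (Real.exp Real.eulerMascheroniConstant)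
  rw [sub_self] at h
  exact h

end Zhao2025

/-! ## The theorems — NAMED FACTS -/

/-- NAMED FACT — **Thm 1**, AS PRINTED: «For each `i ∈ {1, 2}`, the Riemann hypothesis is equivalent to the condition
`∫₂^X E_i(x) dx > 0` for all `X > 2`.» (Printed proof, §3: the explicit formula and Landau's oscillation theorem; cf.
Johnston's `RH ⟺ ∫₂^X (π(x) − li(x)) dx < 0` for all `X > 2`, quoted in §1.1.) RH-EQUIVALENT criterion (both clauses).
Users take `(h : Zhao2025MertensMean_thm1)`.
KERNEL STATUS: **DISCHARGED** — `Zhao2025MertensMean_thm1_holds : Zhao2025MertensMean_thm1`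
(`MertensErrorTermsMeanValueRHThm1Clause2.lean`), both clauses AS PRINTED (for all `X > 2`), standard axioms. Clause 1
(`i = 1`): `Zhao2025MertensMean_thm1_clause1` (`MertensErrorTermsMeanValueRHThm1Clause1.lean`: `⟸` by Landau's theorem,
`Zhao2025.riemannHypothesis_of_integral_E₁_pos`, `MertensErrorTermsMeanValueRHLandau.lean`; `⟹` explicit for `X ≥ 11` from
Rosser–Schoenfeld's Lemma 7 in exact form, `K = β/√X`, `ψ − θ ≥ √t/4`, and `ℰ₁ ∈ (−1.333, −1.2336)` by the kernel-certified
Rosser–Schoenfeld chain; `E₁ > 0` on `[2, 11)` by hand). Clause 2 (`i = 2`): `Zhao2025MertensMean_thm1_clause2`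
(`MertensErrorTermsMeanValueRHThm1Clause2.lean`: `⟸` by Landau's theorem for `π − li`,
`Zhao2025.riemannHypothesis_of_integral_E₂_pos`, `MertensErrorTermsMeanValueRHPiLiLandau.lean`; `⟹` explicit for
`X ≥ 358801 = 599²` through (2.4)–(2.6), the `θ`-tail decomposition `piLiTail_eq`, Schoenfeld's integration by parts against
`ψ₁` for `J(t) = ∫₂ᵗ (θ − u)/(u log² u)` and Chebyshev's elementary bounds for `ψ − θ`; below `358811` by the RH-free kernel
certificate `Zhao2025.E₂_pos_of_lt` — `E₂(x) > 0` for `2 ≤ x < 358811`, `MertensSecondErrorPositive.lean`, the tree's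
counterpart of the source's numerical input «`E_i(x) > 0` for `2 ≤ x ≤ 10⁸`» [RS]). Earlier eventual forms:
`Zhao2025.riemannHypothesis_iff_eventually_integral_E₁_pos` / `…_E₂_pos`, `Zhao2025.tendsto_integral_E₂_atTop_of_RH`; if RH
fails, arbitrarily large positive and negative values (`Zhao2025.frequently_lt_integral_Eᵢ_of_not_RH` /
`…_integral_Eᵢ_lt_of_not_RH`). READING NOTE on the source's
Lemma 7 (2), «`∫₂^∞ (Π(x) − li(x)) x⁻² dx = γ_E + log log 2`»: with the paper's own `li` (for which `li(2) = 1.045…`, cf. the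
constant `ℰ₂ + log log 2 − li(2)/2 = −0.6275…` printed after (2.5), confirmed by the tree's `Zhao2025.meisselMertens_eq_integral`)
the value is `γ_E + log log 2 − li(2)/2 = −0.3118…` (`∫₂^∞ (Π − π)/x² = Σ_{p, k≥2} 1/(k pᵏ) = γ_E − ℰ₂`); the printed value holds
for the offset `Li` (`Li(2) = 0`). The slip does not affect Theorem 1 (the bracket in `F(s)` vanishes at `s = 1` with the true
constant). [cite: Zhao2025MertensMean, Thm 1] -/
def Zhao2025MertensMean_thm1 : Prop :=
  (RiemannHypothesis ↔ ∀ X : ℝ, 2 < X → 0 < ∫ x in (2 : ℝ)..X, Zhao2025.E₁ x) ∧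
  (RiemannHypothesis ↔ ∀ X : ℝ, 2 < X → 0 < ∫ x in (2 : ℝ)..X, Zhao2025.E₂ x)

/-- NAMED FACT — **Thm 2** (the clauses with `Θ < 1`), AS PRINTED: «Let `Θ := sup{Re(ρ) : ζ(ρ) = 0}`. If `Θ = 1/2`, then
`∫₂^X E₃(x) dx > 0` for all `X > 2`. If `1/2 < Θ < 1` […], then `∫₂^X E₃(x) dx` changes sign infinitely often.»
«`Θ = 1/2`» is typed as RH and «`1/2 < Θ < 1`» as «RH fails and the non-trivial zeros stay at distance `≥ δ > 0` from
the line `Re s = 1`» (module docstring); «changes sign infinitely often» = takes positive and negative values beyond every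
`X₀`. The printed third case («`Θ = 1` and Assumption 1 holds») is not typed. RH-CONDITIONAL (clause 1) / conditional on
a failure of RH (clause 2). Users take `(h : Zhao2025MertensMean_thm2)`.
KERNEL STATUS: **DISCHARGED** — `Zhao2025MertensMean_thm2_holds : Zhao2025MertensMean_thm2`
(`MertensErrorTermsMeanValueRHThm2Clause2.lean`), both clauses AS TYPED, standard axioms; the negative half of clause 2
(`Zhao2025.thm2_clause2_neg_of_not_RH`, with the rate forms `Zhao2025.frequently_integral_E₃_lt_neg_rpow_of_zero` /
`Zhao2025.frequently_rpow_lt_integral_E₃_of_zero`, the printed «`∫₂^X E₃ = Ω±(X^{Θ−ε})`») follows the source's §4 in the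
variant it offers on p. 7 («it suffices to trivially bound `∫₂^X (E₂(x))² dx` by inserting classical bounds such as
`ψ(x) − x = O(x^Θ (log x)²)` and `π(x) − li(x) = O(x^Θ log x)` [(4.1)]»): with `Θ = sup{Re ρ : 1/2 < Re ρ < 1} < 1`,
(4.1) (Montgomery–Vaughan §13.1.1 Ex. 1, PROVED in `PrimeNumberTheoremQuasiRH.lean`) gives `E₂ ≪ x^{Θ−1+η}` and
`∫₂^X E₃ ≤ A + e^γ ∫₂^X E₂ + K X^{2Θ−1+2η}`, which Landau's `∫₂^X E₂ = Ω₋(X^{Θ−2η})`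
(`Zhao2025.frequently_integral_E₂_lt_neg_rpow_of_zero`) beats once `η < (1 − Θ)/4`; the mean-square Lemmas 8–9 are not
needed and not formalized. Details by clause:
(clause 1): **PROVED AS PRINTED** — `Zhao2025MertensMean_thm2_clause1 : RH → ∀ X > 2, 0 < ∫₂^X E₃`
(`MertensErrorTermsMeanValueRHThm2Clause1.lean`): for `X ≥ 358801` explicitly (`Zhao2025.integral_E₃_pos_of_RH_of_ge`,
`MertensErrorTermsMeanValueRHThm2LargeX.lean`, via `∫₂^X E₃ ≥ e^γ(∫₂^X E₂ − 2 log(X/2))`, `Zhao2025.E₃_eq_exp` with the tail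
`δ(x) ≤ 2/x`, and the explicit Theorem 1 for `E₂`), below by the RH-free kernel certificate `Zhao2025.E₃_pos_of_lt` —
`E₃(x) > 0` for `2 ≤ x < 358811` (`MertensThirdErrorPositive.lean`; Rosser–Schoenfeld Thm 23 up to `10⁸`); eventual forms
`Zhao2025.tendsto_integral_E₃_atTop_of_RH` (`∫₂^X E₃ → +∞`, `MertensErrorTermsMeanValueRHSufficiencyPiLi.lean`). Clause 2:
its positive half (`∀ X₀, ∃ X ≥ X₀, ∫₂^X E₃ > 0`) is PROVED from the failure of RH alone, without the zero-free-strip hypothesis —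
`Zhao2025.thm2_clause2_pos_of_not_RH` (`MertensErrorTermsMeanValueRHPiLiLandau.lean`: Landau's theorem gives
`∫₂^X E₂ > X^{1/2}` for arbitrarily large `X` at a zero off the line, and `∫₂^X E₃ ≥ e^γ(∫₂^X E₂ − 2 log(X/2))`); the
negative half (`∀ X₀, ∃ X ≥ X₀, ∫₂^X E₃ < 0`, under `¬RH` and the zero-free strip) is `Zhao2025.thm2_clause2_neg_of_not_RH`
(`MertensErrorTermsMeanValueRHThm2Clause2.lean`, as above).
[cite: Zhao2025MertensMean, Thm 2] -/
def Zhao2025MertensMean_thm2 : Prop :=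
  (RiemannHypothesis → ∀ X : ℝ, 2 < X → 0 < ∫ x in (2 : ℝ)..X, Zhao2025.E₃ x) ∧
  (¬ RiemannHypothesis →
    (∃ δ : ℝ, 0 < δ ∧ ∀ ρ : ℂ, riemannZeta ρ = 0 → 0 < ρ.re → ρ.re < 1 → ρ.re ≤ 1 - δ) →
      (∀ X₀ : ℝ, ∃ X : ℝ, X₀ ≤ X ∧ 0 < ∫ x in (2 : ℝ)..X, Zhao2025.E₃ x) ∧
      (∀ X₀ : ℝ, ∃ X : ℝ, X₀ ≤ X ∧ ∫ x in (2 : ℝ)..X, Zhao2025.E₃ x < 0))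

/-- NAMED FACT — **Cor 1**, AS PRINTED: «Assuming RH, for each `i ∈ {1, 2, 3}` and any positive constant
`c < ((2 − B₁)/(2 + B₁))² = 0.9548…`, `∫_{cX}^X E_i(x) dx > 0` for `X ≥ X₀(c)`», where
`B₁ = −2(ξ'/ξ)(0) = 2 + γ_E − log 4π = 0.0461…` ((1.2)), written out. RH-CONDITIONAL.
Users take `(h : Zhao2025MertensMean_cor1)`.
KERNEL STATUS: DISCHARGED — `Zhao2025MertensMean_cor1_holds` (`MertensErrorTermsMeanValueRHProductWindow.lean`), from
`Zhao2025.cor1_E₁_of_RH` (`MertensErrorTermsMeanValueRHWindow.lean`, Rosser–Schoenfeld's Lemma 7 in exact form and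
`ψ − θ ∼ √x`), `Zhao2025.cor1_E₂_of_RH` (`MertensErrorTermsMeanValueRHPiLiWindow.lean`: (2.5)–(2.6) and integration by parts
against the `θ`-tail `∫_u^∞ (θ − t)/t²`, in the quantitative form `∫_{cX}^X E₂ ≥ κ√X/log X`) and `Zhao2025.cor1_E₃_of_RH`
(`E₃ ≥ e^γ(E₂ − 2/x)`), all with the printed threshold and `B₁ = nicolasBeta = 2 + γ − log 4π`.
[cite: Zhao2025MertensMean, Cor 1 (with (1.2) for B₁)] -/
def Zhao2025MertensMean_cor1 : Prop :=
  let B₁ : ℝ := 2 + Real.eulerMascheroniConstant - Real.log (4 * π)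
  RiemannHypothesis → ∀ c : ℝ, 0 < c → c < ((2 - B₁) / (2 + B₁)) ^ 2 →
    ∃ X₀ : ℝ, ∀ X : ℝ, X₀ ≤ X →
      0 < ∫ x in (c * X)..X, Zhao2025.E₁ x ∧ 0 < ∫ x in (c * X)..X, Zhao2025.E₂ x ∧
        0 < ∫ x in (c * X)..X, Zhao2025.E₃ x

end Literature.NumberTheory.LFunctions

end
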